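import Mathlib
import Literature.MathematicalPhysics.QuantumFieldTheory.Balaban1983to89.B1Eq324BenfattoClassDecouplingExtensive
import HarnessLib

/-!
# `Balaban1983to89.B1Eq324BenfattoClassComparisonBoxes` — the COMPARISON BOXES of the (5.13)-substitute
# (`B1Eq324BenfattoClassDecouplingExtensive.decoupling_extensive`): what their per-box Gaussian laws ARE, and how far their
# covariances sit from the conditional covariance `C^Γ` and from the free covariance `G = A⁻¹` — the input of
# [BenfattoEtAl1978] (5.25)–(5.31) pp. 157–158 for a class edition (kernel-generic; PROVED)

statement-level skeleton of published theorems with citation tags; proofs where landed; nothing here is a claim about the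
Yang–Mills mass gap

WHY THIS MODULE (cell `pub-ymgap`, seat `dag-n08-b` gen 8 = node N08 [Balaban1985UV3] «first missing estimate» lane, walking a class
edition of [BenfattoEtAl1978] §5 in printed order).  At an exponentially decaying precision (the situation of [Balaban1985UV3] (58) by
[Balaban1985BackgroundPropagators] Sect. E p. 428) the exact Markov factorisation (5.13) p. 155 is replaced by the two-sided domination
`e^{−ρ}∫F dN(u,(B_bd + R)⁻¹) ≤ ∫F dP̄ ≤ e^{ρ}∫F dN(u,(B_bd − R)⁻¹)` (`B = A|_{Γᶜ}` the conditional precision, `B_bd` its block-diagonal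
part over the boxes, `R = diag(r)` the cross row sums; `…ClassDecouplingExtensive`).  From that point on, EVERY per-box quantity of the
lower chain (5.14)–(5.22) and of the upper chain (5.36) is taken under the box marginal of a COMPARISON measure, and the next printed step,
(5.23)–(5.31) pp. 157–158 (p. 157 L1–2: «The next step consists of trying to replace the conditional expectation 𝓔_{z_{Γ₁}} by the
unconditioned one 𝓔₀.»), needs, for the class — in OUR reading of where the conditioned-versus-free error comes from (Appendix C's decay of the
conditional covariance and centre; print says only what is quoted below) —: (a) WHAT the box marginal of `N(u,(B_bd ∓ R)⁻¹)` is: the Gaussian on the box `p` with precision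
`B|_p ∓ diag(r|_p)` = the «Dirichlet-on-`pᶜ`» precision `A|_p` of the ORIGINAL field shifted by a diagonal TEMPERATURE term carried by the
sites coupled across the corridors (§3–§4: block-diagonal inverse + `GaussianToolkit.measurePreserving_restrictJ`); (b) HOW FAR its covariance
`(A|_p ∓ diag r|_p)⁻¹` is from the free covariance `G|_p` entrywise, with decay INTO the box: a temperature-shift resolvent bound (§2, new) plus
the landed (C.7)-class bound `B1Eq324BenfattoClassAppendixC.abs_cov_sub_schur_le_exp` (Dirichlet vs free) — assembled in §5.  The entrywise
covariance distance is exactly the currency of the chain's «ε-close weights ⟹ close truncated functions»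
(`B1Eq324BenfattoSect5CondToFree.abs_ursellOf_dmoment_sub_le`), which is how (5.31)'s «(error)» is booked.

THE PRINTED TEXT whose class form this serves (page renders `lit-balaban/inprint/lit-balaban-type-B10/benfatto1978-cmp59/bcg_p157.png`,
`bcg_p158.png`, verbatim): p. 157 L1–2 *«The next step consists of trying to replace the conditional expectation 𝓔_{z_{Γ₁}} by the unconditioned
one 𝓔₀.»*; p. 157, before (5.29): *«and the properties of the free field allow to bound the second term of this sum as»* (5.29); p. 158 L1–3, after
(5.29): *«where the first term comes from the replacement of the χ's by 1, the second from the properties of the conditioned measure and from the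
Wick theorem (see Appendix D) and s_k and ϰ̃ are positive constants.»*; p. 158, after (5.31): *«and the error can be studied along the same lines of
the argument leading to the bound (5.30) and has the same form of (5.29) with new constants.»*  That the «properties of the conditioned measure»
entering here are Appendix C's (C.6)–(C.7) (decay of the conditional covariance, control of the centre) is OUR READING of the mechanism, not a
printed sentence; v1.0 of this header misattributed a paraphrase of that reading to p. 158 as «verbatim» (referee dag-ref-C READ-390,
LOCATOR-MISQUOTE) — corrected in this v1.1, docstring only, all declarations byte-identical.

DICTIONARY.  As in `B1Eq324BenfattoClassDecoupling(Extensive)`: a finite index set `m` (= `Γᶜ`), a symmetric `γ`-coercive precision `B`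
(= `A|_{Γᶜ}`), a part map `π : m → σ` («the box containing the site»), the block-diagonal part `B_bd = Matrix.of (π y = π y′ ? B y y′ : 0)`,
cross-row-sum bounds `r`, a real `c` (= `∓1`) and the comparison precision `B_bd + c·diag(r)`; the part `p` as the Finset
`univ.filter (π · = p)`; Gaussian vectors `multivariateGaussian u S` (Mathlib) and the coordinate restriction `GaussianToolkit.restrictJ`.
The class hypotheses (pseudometric `dist`, coercivity, Combes–Thomas rows `Σ_{e′}|M e e′|(cosh(κ·dist e e′) − 1) ≤ J < γ`) are those of
`B1Eq324BenfattoClassAppendixC`.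

WHAT IS PROVED (no definition, no named fact, no `sorry`; axioms standard).
* §1 resolvent bookkeeping: `inv_sub_inv_apply` (`(P⁻¹ − Q⁻¹)_{xz} = Σ_{y,y′} Q⁻¹_{xy}(Q − P)_{yy′}P⁻¹_{y′z}`), `inv_sub_inv_add_diagonal_apply`
  (`(M⁻¹ − (M + diag s)⁻¹)_{xz} = Σ_y (M + diag s)⁻¹_{xy} s_y M⁻¹_{yz}`).
* §2 ★ the TEMPERATURE SHIFT for the class: `form_add_diagonal`, `rowDefect_add_diagonal_eq` (a diagonal shift keeps the Combes–Thomas rows),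
  `coercive_add_diagonal_of_nonneg` / `coercive_add_diagonal_of_abs_le`, ★★ `abs_inv_sub_inv_add_diagonal_le`
  (`|(M⁻¹ − (M + diag s)⁻¹)_{xz}| ≤ Σ_y |s_y|e^{−κ·dist x y}e^{−κ·dist y z}/((γ − J)(γ′ − J))`), `abs_inv_sub_inv_add_diagonal_le_exp`
  (uniform shift: `≤ s_max V₂ e^{−(κ/2)dist x z}/((γ − J)(γ′ − J))`), ★ `abs_inv_sub_inv_add_diagonal_le_profile` (a shift with an exponential
  PROFILE `|s_y| ≤ s₀e^{−κ′ρ(y)}` along a 1-Lipschitz `ρ`, `κ′ ≤ κ/2`: `≤ s₀V₂ e^{−κ′ρ(x)}e^{−(κ/2)dist x z}/((γ − J)(γ′ − J))` — decay into the box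
  AND in the separation).
* §3 block-diagonal inverses (generic): `submatrix_inv_of_blockDiag` (no entries across `π` ⇒ `(N|_T)⁻¹ = (N⁻¹)|_T` on every `π`-saturated `T`).
* §4 the comparison boxes: `comparisonPrecision_submatrix_part` (`(B_bd + c·diag r)|_p = B|_p + c·diag(r|_p)`), ★★ `inv_comparisonPrecision_submatrix_part`
  (`((B_bd + c·diag r)⁻¹)|_p = (B|_p + c·diag(r|_p))⁻¹`), ★ `map_restrictJ_multivariateGaussian_comparison` (the part-`p` marginal of
  `N(u,(B_bd + c·diag r)⁻¹)` IS `N(u|_p,(B|_p + c·diag(r|_p))⁻¹)`), `cross_rowSum_le_exp_of_le_dist` (position-dependent cross row sums: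
  `r_y ≤ M₂e^{−κ′D_y}` when the other parts are at distance `≥ D_y` from `y` — the temperature profile decays into the box),
  `rowDefect_submatrix_le` / `growthSum_submatrix_le` (a box inherits the Combes–Thomas rows and the growth constant — with
  `coercive_submatrix` and §2: every diagonally shifted box stays in the class with `(γ − s_max, J, κ)`),
  ★★ `abs_inv_submatrix_sub_inv_comparisonBox_le` (any index set `T`: the temperature bound with `B`'s class constants inherited).
* §5 what (5.31) reads at the class (one box = `Λᶜ`, «condition on everything outside»): ★★ `abs_inv_dirichletTemp_sub_cov_le`
  (`|((A|_{Λᶜ} + diag s)⁻¹)_{yy′} − G_{yy′}| ≤` temperature term `+ (V₂M₂/(γ − J)²)e^{−(κ/2)(D_y + D_{y′})}`) and its profile edition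
  `abs_inv_dirichletTemp_sub_cov_le_profile`.

HONEST SCOPE.  Kernel-generic matrix analysis and one Gaussian-marginal identity; OUR reading of how (5.25)–(5.31) survive at
[Balaban1985UV3]'s data, not print.  The CENTRE of the comparison boxes is the original conditional centre `u` (common-mean domination,
`…ClassDecoupling.lintegral_multivariateGaussian_mean_le_of_form_le` / the v1.1 mean editions of `…ClassDecouplingExtensive`), so no centre
comparison is needed here; the cumulant-level consequence («ε-close covariances ⇒ close truncated expectations») is the chain's
`B1Eq324BenfattoSect5CondToFree.abs_ursellOf_dmoment_sub_le` and is NOT restated; the §5-side class edition itself is NOT typed (plan g81,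
2026-08-28: port not commissioned beyond definition-free pieces); nothing of [Balaban1985UV3] / [Balaban1985BackgroundPropagators] asserted;
N08 NOT discharged; count-neutral; nothing continuum / OS / mass-gap / Clay.
-/

noncomputable section

open Finset Matrix MeasureTheory ProbabilityTheory WithLp
open scoped BigOperators ENNReal MatrixOrder

namespace Literature.MathematicalPhysics.QuantumFieldTheory.Balaban1983to89.B1Eq324BenfattoClassComparisonBoxes

open Literature.MathematicalPhysics.QuantumFieldTheory
open Literature.MathematicalPhysics.QuantumFieldTheory.GaussianToolkit
open Literature.MathematicalPhysics.QuantumFieldTheory.Balaban1983to89.B1Eq324BenfattoClassAppendixC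
open Literature.MathematicalPhysics.QuantumFieldTheory.Balaban1983to89.B1Eq324BenfattoClassDecoupling
open Literature.MathematicalPhysics.QuantumFieldTheory.Balaban1983to89.B1Eq324BenfattoClassDecouplingExtensive
open Literature.MathematicalPhysics.QuantumFieldTheory.Balaban1983to89.B1Eq324BenfattoClassMarkov

/-! ## §1  Resolvent bookkeeping -/

section Resolvent

variable {n : Type*} [Fintype n] [DecidableEq n]

/-- `P⁻¹ − Q⁻¹ = Q⁻¹(Q − P)P⁻¹` for invertible `P, Q` (cf. the tree's `Literature.Analysis.Matrix.inv_sub_inv_eq_mul`, not imported to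
keep this module light). [cite: HornJohnson2013, §5.8 (the identity A⁻¹ − B⁻¹ = A⁻¹(B − A)B⁻¹)] -/
theorem inv_sub_inv_eq_inv_mul_sub_mul_inv {P Q : Matrix n n ℝ} (hP : IsUnit P.det) (hQ : IsUnit Q.det) :
    P⁻¹ - Q⁻¹ = Q⁻¹ * (Q - P) * P⁻¹ := by
  rw [Matrix.mul_sub, Matrix.sub_mul, Matrix.nonsing_inv_mul _ hQ, Matrix.one_mul, Matrix.mul_assoc,
    Matrix.mul_nonsing_inv _ hP, Matrix.mul_one]

/-- **Entrywise resolvent identity**: `(P⁻¹ − Q⁻¹)_{xz} = Σ_y Σ_{y′} Q⁻¹_{xy}(Q − P)_{yy′}P⁻¹_{y′z}`.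
[cite: HornJohnson2013, §5.8 (the identity A⁻¹ − B⁻¹ = A⁻¹(B − A)B⁻¹, entrywise)] -/
theorem inv_sub_inv_apply {P Q : Matrix n n ℝ} (hP : IsUnit P.det) (hQ : IsUnit Q.det) (x z : n) :
    (P⁻¹ - Q⁻¹) x z = ∑ y, ∑ y', Q⁻¹ x y * (Q - P) y y' * P⁻¹ y' z := by
  rw [inv_sub_inv_eq_inv_mul_sub_mul_inv hP hQ, Matrix.mul_apply]
  simp_rw [Matrix.mul_apply, Finset.sum_mul]
  rw [Finset.sum_comm]

/-- **Diagonal perturbation of the inverse**: `(M⁻¹ − (M + diag s)⁻¹)_{xz} = Σ_y (M + diag s)⁻¹_{xy}·s_y·M⁻¹_{yz}`.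
[cite: HornJohnson2013, §5.8 (the identity A⁻¹ − B⁻¹ = A⁻¹(B − A)B⁻¹, diagonal B − A)] -/
theorem inv_sub_inv_add_diagonal_apply {M : Matrix n n ℝ} (s : n → ℝ) (hM : IsUnit M.det)
    (hMs : IsUnit (M + Matrix.diagonal s).det) (x z : n) :
    (M⁻¹ - (M + Matrix.diagonal s)⁻¹) x z = ∑ y, (M + Matrix.diagonal s)⁻¹ x y * s y * M⁻¹ y z := by
  rw [inv_sub_inv_eq_inv_mul_sub_mul_inv hM hMs, add_sub_cancel_left, Matrix.mul_apply]
  refine Finset.sum_congr rfl fun y _ => ?_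
  rw [Matrix.mul_diagonal]

end Resolvent

/-! ## §2  The TEMPERATURE SHIFT for the class: `M` versus `M + diag(s)` -/

section Temperature

variable {n : Type*} [Fintype n] [DecidableEq n]

omit [Fintype n] [DecidableEq n] in
/-- A pseudometric in the three axioms used here takes nonnegative values. [folklore] -/
private theorem dist_nonneg_of_axioms' {dist : n → n → ℝ} (hd0 : ∀ e, dist e e = 0)
    (hdsymm : ∀ e e', dist e e' = dist e' e) (hdtri : ∀ e e' e'', dist e e'' ≤ dist e e' + dist e' e'')
    (e e' : n) : 0 ≤ dist e e' := by
  have h := hdtri e e' e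
  rw [hd0, hdsymm e' e] at h
  linarith

/-- **The quadratic form of a diagonal shift**: `Σ_{y,y′}(M + diag s)_{yy′}x_y x_{y′} = Σ_{y,y′}M_{yy′}x_y x_{y′} + Σ_y s_y x_y²`.
[cite: HornJohnson2013, §0.9.1 (diagonal matrices)] -/
theorem form_add_diagonal (M : Matrix n n ℝ) (s : n → ℝ) (x : n → ℝ) :
    ∑ y, ∑ y', (M + Matrix.diagonal s) y y' * x y * x y' =
      ∑ y, ∑ y', M y y' * x y * x y' + ∑ y, s y * x y ^ 2 := by
  rw [← Finset.sum_add_distrib]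
  refine Finset.sum_congr rfl fun y _ => ?_
  have hdiag : ∑ y', Matrix.diagonal s y y' * x y * x y' = s y * x y ^ 2 := by
    rw [Finset.sum_eq_single y]
    · rw [Matrix.diagonal_apply_eq]; ring
    · intro y' _ hy'
      rw [Matrix.diagonal_apply_ne _ (Ne.symm hy')]; ring
    · intro h; exact absurd (Finset.mem_univ y) h
  rw [← hdiag, ← Finset.sum_add_distrib]
  refine Finset.sum_congr rfl fun y' _ => ?_
  rw [Matrix.add_apply]; ring

/-- **A diagonal shift keeps the Combes–Thomas rows** (the diagonal carries weight `cosh 0 − 1 = 0`).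
[cite: BenfattoEtAl1978, (5.13) p.155 (class substitute; ours)] -/
theorem rowDefect_add_diagonal_eq (M : Matrix n n ℝ) (s : n → ℝ) {dist : n → n → ℝ} {κ : ℝ}
    (hd0 : ∀ y, dist y y = 0) (y : n) :
    ∑ y', |(M + Matrix.diagonal s) y y'| * (Real.cosh (κ * dist y y') - 1) =
      ∑ y', |M y y'| * (Real.cosh (κ * dist y y') - 1) := by
  refine Finset.sum_congr rfl fun y' _ => ?_
  by_cases h : y = y'
  · subst h
    rw [hd0, mul_zero, Real.cosh_zero, sub_self, mul_zero, mul_zero]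
  · rw [Matrix.add_apply, Matrix.diagonal_apply_ne _ h, add_zero]

omit [DecidableEq n] in
/-- **A nonnegative diagonal shift keeps coercivity** (`s ≥ 0` ⇒ `M + diag s` is still `γ`-coercive).
[cite: HornJohnson2013, Thm 4.3.1 (Weyl; monotonicity under a positive semidefinite perturbation)] -/
theorem coercive_add_diagonal_of_nonneg [DecidableEq n] {M : Matrix n n ℝ} {γ : ℝ}
    (hγ : ∀ x : n → ℝ, γ * ∑ y, x y ^ 2 ≤ ∑ y, ∑ y', M y y' * x y * x y') {s : n → ℝ} (hs : ∀ y, 0 ≤ s y)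
    (x : n → ℝ) : γ * ∑ y, x y ^ 2 ≤ ∑ y, ∑ y', (M + Matrix.diagonal s) y y' * x y * x y' := by
  rw [form_add_diagonal]
  have h0 : 0 ≤ ∑ y, s y * x y ^ 2 := Finset.sum_nonneg fun y _ => mul_nonneg (hs y) (sq_nonneg _)
  linarith [hγ x]

omit [DecidableEq n] in
/-- **A bounded diagonal shift costs at most its size in coercivity** (`|s| ≤ s_max` ⇒ `M + diag s` is `(γ − s_max)`-coercive).
[cite: HornJohnson2013, Thm 4.3.1 (Weyl; eigenvalue perturbation by a bounded Hermitian matrix)] -/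
theorem coercive_add_diagonal_of_abs_le [DecidableEq n] {M : Matrix n n ℝ} {γ smax : ℝ}
    (hγ : ∀ x : n → ℝ, γ * ∑ y, x y ^ 2 ≤ ∑ y, ∑ y', M y y' * x y * x y') {s : n → ℝ} (hs : ∀ y, |s y| ≤ smax)
    (x : n → ℝ) : (γ - smax) * ∑ y, x y ^ 2 ≤ ∑ y, ∑ y', (M + Matrix.diagonal s) y y' * x y * x y' := by
  rw [form_add_diagonal, sub_mul]
  have h1 : ∀ y, -(smax * x y ^ 2) ≤ s y * x y ^ 2 := fun y => by
    have := neg_abs_le (s y)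
    have := hs y
    nlinarith [sq_nonneg (x y)]
  have h2 : -(∑ y, smax * x y ^ 2) ≤ ∑ y, s y * x y ^ 2 := by
    rw [← Finset.sum_neg_distrib]
    exact Finset.sum_le_sum fun y _ => h1 y
  have h3 : smax * ∑ y, x y ^ 2 = ∑ y, smax * x y ^ 2 := Finset.mul_sum _ _ _
  linarith [hγ x]

variable {M : Matrix n n ℝ} {dist : n → n → ℝ} {γ γ' J κ : ℝ}

/-- **THE TEMPERATURE SHIFT (class form).**  Let `M` be symmetric, `γ`-coercive, with Combes–Thomas rows
`Σ_{e′}|M e e′|(cosh(κ·dist e e′) − 1) ≤ J < γ` for a pseudometric `dist`, and let `s` be a diagonal shift such that `M + diag s` is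
`γ′`-coercive with `J < γ′`.  Then, entrywise,
`|(M⁻¹ − (M + diag s)⁻¹)_{xz}| ≤ Σ_y |s_y|·e^{−κ·dist x y}·e^{−κ·dist y z} / ((γ − J)(γ′ − J))`
(the resolvent identity of §1 with both inverses bounded by `B1Eq324BenfattoClassAppendixC.abs_inv_apply_le_exp`; the shifted matrix has the
same Combes–Thomas rows).  This is the covariance distance between a comparison box `N(u,(A|_p ∓ diag r|_p)⁻¹)` of the (5.13)-substitute
and the Dirichlet box `N(u,(A|_p)⁻¹)` of the original field. [cite: BenfattoEtAl1978, (5.31) p.158 (class substitute; ours)] -/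
theorem abs_inv_sub_inv_add_diagonal_le (hM : ∀ y y', M y y' = M y' y)
    (hd0 : ∀ e, dist e e = 0) (hdsymm : ∀ e e', dist e e' = dist e' e)
    (hdtri : ∀ e e' e'', dist e e'' ≤ dist e e' + dist e' e'') (hγ0 : 0 < γ) (hγ'0 : 0 < γ')
    (hγ : ∀ x : n → ℝ, γ * ∑ y, x y ^ 2 ≤ ∑ y, ∑ y', M y y' * x y * x y')
    (s : n → ℝ) (hγ' : ∀ x : n → ℝ, γ' * ∑ y, x y ^ 2 ≤ ∑ y, ∑ y', (M + Matrix.diagonal s) y y' * x y * x y')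
    (hJ : ∀ e, ∑ e', |M e e'| * (Real.cosh (κ * dist e e') - 1) ≤ J) (hκ : 0 ≤ κ) (hm : J < γ) (hm' : J < γ')
    (x z : n) :
    |M⁻¹ x z - (M + Matrix.diagonal s)⁻¹ x z| ≤
      (∑ y, |s y| * Real.exp (-(κ * dist x y)) * Real.exp (-(κ * dist y z))) / ((γ - J) * (γ' - J)) := by
  have hγJ : 0 < γ - J := by linarith
  have hγ'J : 0 < γ' - J := by linarith
  have hMs_symm : ∀ y y', (M + Matrix.diagonal s) y y' = (M + Matrix.diagonal s) y' y := fun y y' => by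
    rw [Matrix.add_apply, Matrix.add_apply, hM y y']
    by_cases h : y = y'
    · subst h; rfl
    · rw [Matrix.diagonal_apply_ne _ h, Matrix.diagonal_apply_ne _ (Ne.symm h)]
  have hJs : ∀ e, ∑ e', |(M + Matrix.diagonal s) e e'| * (Real.cosh (κ * dist e e') - 1) ≤ J := fun e => by
    rw [rowDefect_add_diagonal_eq M s hd0 e]; exact hJ e
  have hMdet : IsUnit M.det := (Matrix.isUnit_iff_isUnit_det M).mp (posDef_of_coercive hM hγ0 hγ).isUnit
  have hMsdet : IsUnit (M + Matrix.diagonal s).det :=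
    (Matrix.isUnit_iff_isUnit_det _).mp (posDef_of_coercive hMs_symm hγ'0 hγ').isUnit
  rw [← Matrix.sub_apply, inv_sub_inv_add_diagonal_apply s hMdet hMsdet x z]
  refine (Finset.abs_sum_le_sum_abs _ _).trans ?_
  rw [Finset.sum_div]
  refine Finset.sum_le_sum fun y _ => ?_
  rw [abs_mul, abs_mul]
  have h1 := abs_inv_apply_le_exp hMs_symm hd0 hdsymm hdtri hγ'0 hγ' hJs hκ hm' x y
  have h2 := abs_inv_apply_le_exp hM hd0 hdsymm hdtri hγ0 hγ hJ hκ hm y z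
  calc |(M + Matrix.diagonal s)⁻¹ x y| * |s y| * |M⁻¹ y z|
      ≤ Real.exp (-(κ * dist x y)) / (γ' - J) * |s y| * (Real.exp (-(κ * dist y z)) / (γ - J)) :=
        mul_le_mul (mul_le_mul_of_nonneg_right h1 (abs_nonneg _)) h2 (abs_nonneg _) (by positivity)
    _ = |s y| * Real.exp (-(κ * dist x y)) * Real.exp (-(κ * dist y z)) / ((γ - J) * (γ' - J)) := by
        field_simp
        try ring

/-- **Temperature shift, uniform size**: if moreover `|s_y| ≤ s_max` and `Σ_{e′} e^{−(κ/2)·dist e e′} ≤ V₂` (growth constant), then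
`|(M⁻¹ − (M + diag s)⁻¹)_{xz}| ≤ (s_max V₂/((γ − J)(γ′ − J)))·e^{−(κ/2)·dist x z}`.
[cite: BenfattoEtAl1978, (5.31) p.158 (class substitute; ours)] -/
theorem abs_inv_sub_inv_add_diagonal_le_exp (hM : ∀ y y', M y y' = M y' y)
    (hd0 : ∀ e, dist e e = 0) (hdsymm : ∀ e e', dist e e' = dist e' e)
    (hdtri : ∀ e e' e'', dist e e'' ≤ dist e e' + dist e' e'') (hγ0 : 0 < γ) (hγ'0 : 0 < γ')
    (hγ : ∀ x : n → ℝ, γ * ∑ y, x y ^ 2 ≤ ∑ y, ∑ y', M y y' * x y * x y')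
    (s : n → ℝ) (hγ' : ∀ x : n → ℝ, γ' * ∑ y, x y ^ 2 ≤ ∑ y, ∑ y', (M + Matrix.diagonal s) y y' * x y * x y')
    (hJ : ∀ e, ∑ e', |M e e'| * (Real.cosh (κ * dist e e') - 1) ≤ J) (hκ : 0 ≤ κ) (hm : J < γ) (hm' : J < γ')
    {smax V₂ : ℝ} (hs : ∀ y, |s y| ≤ smax) (hV : ∀ e, ∑ e', Real.exp (-(κ / 2 * dist e e')) ≤ V₂)
    (x z : n) :
    |M⁻¹ x z - (M + Matrix.diagonal s)⁻¹ x z| ≤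
      smax * V₂ / ((γ - J) * (γ' - J)) * Real.exp (-(κ / 2 * dist x z)) := by
  have hγJ : 0 < γ - J := by linarith
  have hγ'J : 0 < γ' - J := by linarith
  have hdnn := dist_nonneg_of_axioms' hd0 hdsymm hdtri
  have hsmax : 0 ≤ smax := by
    rcases isEmpty_or_nonempty n with hn | hn
    · exact (IsEmpty.false x).elim
    · exact le_trans (abs_nonneg _) (hs x)
  refine (abs_inv_sub_inv_add_diagonal_le hM hd0 hdsymm hdtri hγ0 hγ'0 hγ s hγ' hJ hκ hm hm' x z).trans ?_
  rw [div_le_iff₀ (mul_pos hγJ hγ'J)]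
  have hterm : ∀ y, |s y| * Real.exp (-(κ * dist x y)) * Real.exp (-(κ * dist y z)) ≤
      smax * Real.exp (-(κ / 2 * dist x z)) * Real.exp (-(κ / 2 * dist x y)) := by
    intro y
    have hexp : Real.exp (-(κ * dist x y)) * Real.exp (-(κ * dist y z)) ≤
        Real.exp (-(κ / 2 * dist x z)) * Real.exp (-(κ / 2 * dist x y)) := by
      rw [← Real.exp_add, ← Real.exp_add]
      refine Real.exp_le_exp.mpr ?_
      have := hdtri x y z
      have := hdnn x y
      have := hdnn y z
      nlinarith
    calc |s y| * Real.exp (-(κ * dist x y)) * Real.exp (-(κ * dist y z))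
        = |s y| * (Real.exp (-(κ * dist x y)) * Real.exp (-(κ * dist y z))) := by ring
      _ ≤ smax * (Real.exp (-(κ / 2 * dist x z)) * Real.exp (-(κ / 2 * dist x y))) :=
          mul_le_mul (hs y) hexp (by positivity) hsmax
      _ = _ := by ring
  calc ∑ y, |s y| * Real.exp (-(κ * dist x y)) * Real.exp (-(κ * dist y z))
      ≤ ∑ y, smax * Real.exp (-(κ / 2 * dist x z)) * Real.exp (-(κ / 2 * dist x y)) :=
        Finset.sum_le_sum fun y _ => hterm y
    _ = smax * Real.exp (-(κ / 2 * dist x z)) * ∑ y, Real.exp (-(κ / 2 * dist x y)) := by rw [Finset.mul_sum]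
    _ ≤ smax * Real.exp (-(κ / 2 * dist x z)) * V₂ :=
        mul_le_mul_of_nonneg_left (hV x) (by positivity)
    _ = smax * V₂ / ((γ - J) * (γ' - J)) * Real.exp (-(κ / 2 * dist x z)) * ((γ - J) * (γ' - J)) := by
        field_simp

/-- **Temperature shift with an exponential PROFILE** (the shape at a comparison box: the cross row sums `r_y` decay with the distance of
`y` to the OTHER parts): if `|s_y| ≤ s₀e^{−κ′ρ(y)}` along a 1-Lipschitz profile `ρ` (`ρ(y) ≤ ρ(y′) + dist y y′`), with `0 ≤ κ′ ≤ κ/2` and the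
growth constant `Σ_{e′} e^{−(κ/2)·dist e e′} ≤ V₂`, then
`|(M⁻¹ − (M + diag s)⁻¹)_{xz}| ≤ (s₀V₂/((γ − J)(γ′ − J)))·e^{−κ′ρ(x)}·e^{−(κ/2)·dist x z}` — small deep inside the box and decaying in the
separation, which is the (5.31) «(error)» currency. [cite: BenfattoEtAl1978, (5.31) p.158 (class substitute; ours)] -/
theorem abs_inv_sub_inv_add_diagonal_le_profile (hM : ∀ y y', M y y' = M y' y)
    (hd0 : ∀ e, dist e e = 0) (hdsymm : ∀ e e', dist e e' = dist e' e)
    (hdtri : ∀ e e' e'', dist e e'' ≤ dist e e' + dist e' e'') (hγ0 : 0 < γ) (hγ'0 : 0 < γ')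
    (hγ : ∀ x : n → ℝ, γ * ∑ y, x y ^ 2 ≤ ∑ y, ∑ y', M y y' * x y * x y')
    (s : n → ℝ) (hγ' : ∀ x : n → ℝ, γ' * ∑ y, x y ^ 2 ≤ ∑ y, ∑ y', (M + Matrix.diagonal s) y y' * x y * x y')
    (hJ : ∀ e, ∑ e', |M e e'| * (Real.cosh (κ * dist e e') - 1) ≤ J) (hκ : 0 ≤ κ) (hm : J < γ) (hm' : J < γ')
    {s₀ κ' V₂ : ℝ} (ρ : n → ℝ) (hρ : ∀ y y', ρ y ≤ ρ y' + dist y y') (hκ' : 0 ≤ κ') (hκ'2 : κ' ≤ κ / 2)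
    (hs0 : 0 ≤ s₀) (hs : ∀ y, |s y| ≤ s₀ * Real.exp (-(κ' * ρ y)))
    (hV : ∀ e, ∑ e', Real.exp (-(κ / 2 * dist e e')) ≤ V₂) (x z : n) :
    |M⁻¹ x z - (M + Matrix.diagonal s)⁻¹ x z| ≤
      s₀ * V₂ / ((γ - J) * (γ' - J)) * Real.exp (-(κ' * ρ x)) * Real.exp (-(κ / 2 * dist x z)) := by
  have hγJ : 0 < γ - J := by linarith
  have hγ'J : 0 < γ' - J := by linarith
  have hdnn := dist_nonneg_of_axioms' hd0 hdsymm hdtri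
  refine (abs_inv_sub_inv_add_diagonal_le hM hd0 hdsymm hdtri hγ0 hγ'0 hγ s hγ' hJ hκ hm hm' x z).trans ?_
  rw [div_le_iff₀ (mul_pos hγJ hγ'J)]
  have hterm : ∀ y, |s y| * Real.exp (-(κ * dist x y)) * Real.exp (-(κ * dist y z)) ≤
      s₀ * Real.exp (-(κ' * ρ x)) * Real.exp (-(κ / 2 * dist x z)) * Real.exp (-(κ / 2 * dist z y)) := by
    intro y
    have hexp : Real.exp (-(κ' * ρ y)) * (Real.exp (-(κ * dist x y)) * Real.exp (-(κ * dist y z))) ≤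
        Real.exp (-(κ' * ρ x)) * Real.exp (-(κ / 2 * dist x z)) * Real.exp (-(κ / 2 * dist z y)) := by
      rw [← Real.exp_add, ← Real.exp_add, ← Real.exp_add, ← Real.exp_add]
      refine Real.exp_le_exp.mpr ?_
      have h1 := hρ x y
      have h2 := hdtri x y z
      have h3 := hdnn x y
      have h4 := hdnn y z
      have h5 := hdsymm z y
      rw [h5]
      nlinarith
    calc |s y| * Real.exp (-(κ * dist x y)) * Real.exp (-(κ * dist y z))
        = |s y| * (Real.exp (-(κ * dist x y)) * Real.exp (-(κ * dist y z))) := by ring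
      _ ≤ s₀ * Real.exp (-(κ' * ρ y)) * (Real.exp (-(κ * dist x y)) * Real.exp (-(κ * dist y z))) :=
          mul_le_mul_of_nonneg_right (hs y) (by positivity)
      _ = s₀ * (Real.exp (-(κ' * ρ y)) * (Real.exp (-(κ * dist x y)) * Real.exp (-(κ * dist y z)))) := by ring
      _ ≤ s₀ * (Real.exp (-(κ' * ρ x)) * Real.exp (-(κ / 2 * dist x z)) * Real.exp (-(κ / 2 * dist z y))) :=
          mul_le_mul_of_nonneg_left hexp hs0
      _ = _ := by ring
  calc ∑ y, |s y| * Real.exp (-(κ * dist x y)) * Real.exp (-(κ * dist y z))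
      ≤ ∑ y, s₀ * Real.exp (-(κ' * ρ x)) * Real.exp (-(κ / 2 * dist x z)) * Real.exp (-(κ / 2 * dist z y)) :=
        Finset.sum_le_sum fun y _ => hterm y
    _ = s₀ * Real.exp (-(κ' * ρ x)) * Real.exp (-(κ / 2 * dist x z)) * ∑ y, Real.exp (-(κ / 2 * dist z y)) := by
        rw [Finset.mul_sum]
    _ ≤ s₀ * Real.exp (-(κ' * ρ x)) * Real.exp (-(κ / 2 * dist x z)) * V₂ :=
        mul_le_mul_of_nonneg_left (hV z) (by positivity)
    _ = s₀ * V₂ / ((γ - J) * (γ' - J)) * Real.exp (-(κ' * ρ x)) * Real.exp (-(κ / 2 * dist x z)) *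
          ((γ - J) * (γ' - J)) := by
        field_simp

end Temperature

/-! ## §3  Block-diagonal inverses (generic) -/

section BlockDiag

variable {m σ : Type*} [Fintype m] [DecidableEq m]

/-- **Inverse of a block-diagonal matrix, blockwise**: if the invertible `N` has no entries across the partition `π` (`N y y′ = 0` whenever
`π y ≠ π y′`) and the index set `T` is `π`-saturated (a union of parts), then `(N|_T)⁻¹ = (N⁻¹)|_T`.
[cite: HornJohnson2013, §0.9.2 (block diagonal matrices; the inverse is block diagonal with the inverse blocks)] -/
theorem submatrix_inv_of_blockDiag {N : Matrix m m ℝ} (hN : IsUnit N.det) (π : m → σ)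
    (hbd : ∀ y y', π y ≠ π y' → N y y' = 0) (T : Finset m) (hT : ∀ y ∈ T, ∀ y', π y' = π y → y' ∈ T) :
    (N.submatrix (fun j : T => (j : m)) (fun j : T => (j : m)))⁻¹ =
      (N⁻¹).submatrix (fun j : T => (j : m)) (fun j : T => (j : m)) := by
  apply Matrix.inv_eq_right_inv
  ext a b
  rw [Matrix.mul_apply]
  have hfull : ∑ y, N a y * N⁻¹ y b = (1 : Matrix m m ℝ) a b := by
    rw [← Matrix.mul_apply, Matrix.mul_nonsing_inv _ hN]
  have hvan : ∀ y ∈ (Finset.univ : Finset m), y ∉ T → N a y * N⁻¹ y b = 0 := by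
    intro y _ hy
    have hπ : π (a : m) ≠ π y := fun h => hy (hT a a.2 y h.symm)
    rw [hbd _ _ hπ, zero_mul]
  calc ∑ y : T, N.submatrix (fun j : T => (j : m)) (fun j : T => (j : m)) a y *
        (N⁻¹).submatrix (fun j : T => (j : m)) (fun j : T => (j : m)) y b
      = ∑ y ∈ T, N a y * N⁻¹ y b := by
          simp only [Matrix.submatrix_apply]
          exact Finset.sum_coe_sort T (fun y => N a y * N⁻¹ y b)
    _ = ∑ y, N a y * N⁻¹ y b := Finset.sum_subset (Finset.subset_univ T) hvan
    _ = (1 : Matrix m m ℝ) a b := hfull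
    _ = (1 : Matrix T T ℝ) a b := by
          simp only [Matrix.one_apply, Subtype.ext_iff]

end BlockDiag

/-! ## §4  The comparison boxes of `decoupling_extensive` -/

section ComparisonBoxes

variable {m σ : Type*} [Fintype m] [DecidableEq m] [DecidableEq σ]

/-- **The box block of a comparison precision**: restricted to the part `p`, `B_bd + c·diag(r)` is `B|_p + c·diag(r|_p)` — the Dirichlet
box precision of the original field shifted by a diagonal temperature term. [cite: BenfattoEtAl1978, (5.13) p.155 (class substitute; ours)] -/
theorem comparisonPrecision_submatrix_part (B : Matrix m m ℝ) (π : m → σ) (r : m → ℝ) (c : ℝ) (p : σ) :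
    (((Matrix.of fun y y' => if π y = π y' then B y y' else 0 : Matrix m m ℝ) + c • Matrix.diagonal r).submatrix
        (fun j : ↥(Finset.univ.filter fun y => π y = p) => (j : m))
        (fun j : ↥(Finset.univ.filter fun y => π y = p) => (j : m))) =
      B.submatrix (fun j : ↥(Finset.univ.filter fun y => π y = p) => (j : m))
          (fun j : ↥(Finset.univ.filter fun y => π y = p) => (j : m)) +
        c • Matrix.diagonal (fun j : ↥(Finset.univ.filter fun y => π y = p) => r j) := by
  ext a b
  have ha : π (a : m) = p := (Finset.mem_filter.mp a.2).2
  have hb : π (b : m) = p := (Finset.mem_filter.mp b.2).2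
  simp only [Matrix.submatrix_apply, Matrix.add_apply, Matrix.of_apply, Matrix.smul_apply, smul_eq_mul]
  rw [if_pos (ha.trans hb.symm)]
  by_cases hab : a = b
  · subst hab
    rw [Matrix.diagonal_apply_eq, Matrix.diagonal_apply_eq]
  · have hab' : (a : m) ≠ (b : m) := fun h => hab (Subtype.ext h)
    rw [Matrix.diagonal_apply_ne _ hab', Matrix.diagonal_apply_ne _ hab]

/-- **The box block of a comparison COVARIANCE is the inverse of the box precision**: `((B_bd + c·diag r)⁻¹)|_p = (B|_p + c·diag(r|_p))⁻¹`
(the comparison precisions have no entries across the partition). [cite: BenfattoEtAl1978, (5.13) p.155 (class substitute; ours)] -/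
theorem inv_comparisonPrecision_submatrix_part (B : Matrix m m ℝ) (π : m → σ) (r : m → ℝ) (c : ℝ) (p : σ)
    (hN : IsUnit (((Matrix.of fun y y' => if π y = π y' then B y y' else 0 : Matrix m m ℝ) + c • Matrix.diagonal r).det)) :
    (((Matrix.of fun y y' => if π y = π y' then B y y' else 0 : Matrix m m ℝ) + c • Matrix.diagonal r)⁻¹).submatrix
        (fun j : ↥(Finset.univ.filter fun y => π y = p) => (j : m))
        (fun j : ↥(Finset.univ.filter fun y => π y = p) => (j : m)) =
      (B.submatrix (fun j : ↥(Finset.univ.filter fun y => π y = p) => (j : m))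
          (fun j : ↥(Finset.univ.filter fun y => π y = p) => (j : m)) +
        c • Matrix.diagonal (fun j : ↥(Finset.univ.filter fun y => π y = p) => r j))⁻¹ := by
  rw [← comparisonPrecision_submatrix_part B π r c p]
  symm
  refine submatrix_inv_of_blockDiag hN π (fun y y' hyy' => ?_) _ (fun y hy y' hy' => ?_)
  · have hne : y ≠ y' := fun h => hyy' (by rw [h])
    simp only [Matrix.add_apply, Matrix.of_apply, if_neg hyy', Matrix.smul_apply, Matrix.diagonal_apply_ne _ hne,
      smul_zero, add_zero]
  · rw [Finset.mem_filter] at hy ⊢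
    exact ⟨Finset.mem_univ _, hy'.trans hy.2⟩

omit [Fintype m] [DecidableEq m] [DecidableEq σ] in
/-- Restriction of coordinates commutes with translation (linearity of `restrictJ`). [folklore] -/
private theorem restrictJ_add (J : Finset m) (u x : EuclideanSpace ℝ m) :
    restrictJ J (u + x) = restrictJ J u + restrictJ J x :=
  map_add (restrictJ J) u x

/-- **THE BOX MARGINAL OF A COMPARISON MEASURE.**  For a positive definite comparison precision `N = B_bd + c·diag(r)` and any centre `u`,
the law of the part-`p` coordinates under `N(u, N⁻¹)` is `N(u|_p, (B|_p + c·diag(r|_p))⁻¹)`: the Gaussian on the box with the Dirichlet box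
precision of the original field at a shifted temperature (Mathlib marginal `GaussianToolkit.measurePreserving_restrictJ` + the blockwise
inverse).  After the (5.13)-substitute, THIS is the per-box measure under which (5.14)–(5.22) / (5.36) are run.
[cite: BenfattoEtAl1978, (5.13) p.155 (class substitute; ours)] -/
theorem map_restrictJ_multivariateGaussian_comparison (B : Matrix m m ℝ) (π : m → σ) (r : m → ℝ) (c : ℝ) (p : σ)
    (hN : ((Matrix.of fun y y' => if π y = π y' then B y y' else 0 : Matrix m m ℝ) + c • Matrix.diagonal r).PosDef)
    (u : EuclideanSpace ℝ m) :
    (multivariateGaussian u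
        (((Matrix.of fun y y' => if π y = π y' then B y y' else 0 : Matrix m m ℝ) + c • Matrix.diagonal r))⁻¹).map
        (restrictJ (Finset.univ.filter fun y => π y = p)) =
      multivariateGaussian (restrictJ (Finset.univ.filter fun y => π y = p) u)
        (B.submatrix (fun j : ↥(Finset.univ.filter fun y => π y = p) => (j : m))
            (fun j : ↥(Finset.univ.filter fun y => π y = p) => (j : m)) +
          c • Matrix.diagonal (fun j : ↥(Finset.univ.filter fun y => π y = p) => r j))⁻¹ := by
  set N : Matrix m m ℝ := ((Matrix.of fun y y' => if π y = π y' then B y y' else 0 : Matrix m m ℝ) +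
    c • Matrix.diagonal r) with hNdef
  set J : Finset m := Finset.univ.filter fun y => π y = p with hJdef
  have hdet : IsUnit N.det := (Matrix.isUnit_iff_isUnit_det N).mp hN.isUnit
  have hS : (N⁻¹).PosSemidef := hN.inv.posSemidef
  have hmp := (measurePreserving_restrictJ hS J).map_eq
  rw [← inv_comparisonPrecision_submatrix_part B π r c p hdet]
  rw [multivariateGaussian_eq_map_add u N⁻¹,
    multivariateGaussian_eq_map_add (restrictJ J u) ((N⁻¹).submatrix (fun j : J => (j : m)) (fun j : J => (j : m))),
    Measure.map_map (restrictJ J).continuous.measurable (measurable_const_add u)]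
  have hcomp : (restrictJ J : EuclideanSpace ℝ m → EuclideanSpace ℝ J) ∘ (fun x => u + x) =
      (fun z => restrictJ J u + z) ∘ (restrictJ J) := by
    funext x
    simp only [Function.comp_apply, restrictJ_add]
  rw [hcomp, ← Measure.map_map (measurable_const_add _) (restrictJ J).continuous.measurable, hmp]

omit [DecidableEq m] in
/-- **Position-dependent cross row sums**: if `Σ_{y′} |B y y′|e^{κ′·dist y y′} ≤ M₂` and every site of ANOTHER part is at distance `≥ D_y`
from `y`, then `Σ_{π y′ ≠ π y} |B y y′| ≤ M₂e^{−κ′D_y}` — the temperature profile of a comparison box decays with the distance to the other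
boxes (the uniform edition is `B1Eq324BenfattoClassDecoupling.cross_rowSum_le_exp`). [cite: BenfattoEtAl1978, (5.13) p.155 (class substitute; ours)] -/
theorem cross_rowSum_le_exp_of_le_dist {B : Matrix m m ℝ} (π : m → σ) {dist : m → m → ℝ} {κ' M₂ : ℝ}
    (hκ : 0 ≤ κ') (hM : ∀ y, ∑ y', |B y y'| * Real.exp (κ' * dist y y') ≤ M₂) (y : m) {D : ℝ}
    (hD : ∀ y', π y ≠ π y' → D ≤ dist y y') :
    ∑ y', (if π y = π y' then (0 : ℝ) else |B y y'|) ≤ M₂ * Real.exp (-(κ' * D)) := by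
  have hterm : ∀ y', (if π y = π y' then (0 : ℝ) else |B y y'|) ≤
      |B y y'| * Real.exp (κ' * dist y y') * Real.exp (-(κ' * D)) := by
    intro y'
    by_cases h : π y = π y'
    · rw [if_pos h]; positivity
    · rw [if_neg h]
      have hw := hD y' h
      have hexp : 1 ≤ Real.exp (κ' * dist y y') * Real.exp (-(κ' * D)) := by
        rw [← Real.exp_add]
        exact Real.one_le_exp (by nlinarith)
      calc |B y y'| = |B y y'| * 1 := (mul_one _).symm
        _ ≤ |B y y'| * (Real.exp (κ' * dist y y') * Real.exp (-(κ' * D))) :=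
            mul_le_mul_of_nonneg_left hexp (abs_nonneg _)
        _ = _ := by ring
  calc ∑ y', (if π y = π y' then (0 : ℝ) else |B y y'|)
      ≤ ∑ y', |B y y'| * Real.exp (κ' * dist y y') * Real.exp (-(κ' * D)) := Finset.sum_le_sum fun y' _ => hterm y'
    _ = (∑ y', |B y y'| * Real.exp (κ' * dist y y')) * Real.exp (-(κ' * D)) := by rw [Finset.sum_mul]
    _ ≤ M₂ * Real.exp (-(κ' * D)) := mul_le_mul_of_nonneg_right (hM y) (Real.exp_pos _).le

omit [DecidableEq m] [DecidableEq σ] in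
/-- **A Combes–Thomas row bound passes to every principal submatrix** (fewer nonnegative terms) — with `coercive_submatrix`
(`B1Eq324BenfattoClassAppendixC`), `rowDefect_add_diagonal_eq` and `coercive_add_diagonal_of_abs_le` this says: every diagonally shifted box
`B|_T + diag(s)`, `|s| ≤ s_max`, is in the class with constants `(γ − s_max, J, κ)` — the class is carried through the temperatures of the
(5.13)-substitute, depth after depth. [cite: HornJohnson2013, Thm 4.3.28 (principal submatrices; the row sums only lose terms)] -/
theorem rowDefect_submatrix_le {B : Matrix m m ℝ} {dist : m → m → ℝ} {κ J : ℝ}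
    (hJ : ∀ e, ∑ e', |B e e'| * (Real.cosh (κ * dist e e') - 1) ≤ J) (T : Finset m) (y : T) :
    ∑ y' : T, |B.submatrix (fun j : T => (j : m)) (fun j : T => (j : m)) y y'| *
        (Real.cosh (κ * dist (y : m) (y' : m)) - 1) ≤ J := by
  have h := Finset.sum_coe_sort T (fun e' => |B y e'| * (Real.cosh (κ * dist (y : m) e') - 1))
  simp only [Matrix.submatrix_apply]
  rw [h]
  refine le_trans (Finset.sum_le_univ_sum_of_nonneg fun e' => mul_nonneg (abs_nonneg _) ?_) (hJ y)
  linarith [Real.one_le_cosh (κ * dist (y : m) e')]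

omit [DecidableEq m] [DecidableEq σ] in
/-- **A growth-sum bound passes to every subset of indices** (the box inherits the growth constant `V₂`).
[cite: BenfattoEtAl1978, Appendix C (C.5) p.164 (class form; lattice growth sums restricted to a box)] -/
theorem growthSum_submatrix_le {dist : m → m → ℝ} {κ V₂ : ℝ}
    (hV : ∀ e, ∑ e', Real.exp (-(κ / 2 * dist e e')) ≤ V₂) (T : Finset m) (y : T) :
    ∑ y' : T, Real.exp (-(κ / 2 * dist (y : m) (y' : m))) ≤ V₂ := by
  have h := Finset.sum_coe_sort T (fun e' => Real.exp (-(κ / 2 * dist (y : m) e')))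
  rw [h]
  exact le_trans (Finset.sum_le_univ_sum_of_nonneg fun e' => (Real.exp_pos _).le) (hV y)

/-- **THE TEMPERATURE BOUND ON A COMPARISON BOX.**  For `B` symmetric, `γ`-coercive, with Combes–Thomas rows `≤ J < γ` (pseudometric
`dist`), cross-row-sum bounds `0 ≤ r ≤ r_max` with `|c|·r_max + J < γ`, and ANY index set `T` (a part `p` of the partition:
`T = univ.filter (π · = p)`, cf. `inv_comparisonPrecision_submatrix_part`): the covariance of the comparison box `(B|_T + c·diag(r|_T))⁻¹` and the
Dirichlet box covariance `(B|_T)⁻¹` differ entrywise by at most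
`Σ_{y∈T} |c|r_y e^{−κ·dist a y}e^{−κ·dist y b}/((γ − J)(γ − |c|r_max − J))` — `B`'s class constants are inherited by the box.
(Feed `r` from `cross_rowSum_le_exp_of_le_dist` to get the profile form of `abs_inv_sub_inv_add_diagonal_le_profile`.)
[cite: BenfattoEtAl1978, (5.31) p.158 (class substitute; ours)] -/
theorem abs_inv_submatrix_sub_inv_comparisonBox_le {B : Matrix m m ℝ} (hB : ∀ y y', B y y' = B y' y)
    {dist : m → m → ℝ} (hd0 : ∀ e, dist e e = 0) (hdsymm : ∀ e e', dist e e' = dist e' e)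
    (hdtri : ∀ e e' e'', dist e e'' ≤ dist e e' + dist e' e'') {γ J κ rmax : ℝ} (c : ℝ)
    (hγ : ∀ x : m → ℝ, γ * ∑ y, x y ^ 2 ≤ ∑ y, ∑ y', B y y' * x y * x y')
    (hJ : ∀ e, ∑ e', |B e e'| * (Real.cosh (κ * dist e e') - 1) ≤ J) (hκ : 0 ≤ κ) (hm : J < γ)
    (r : m → ℝ) (hr0 : ∀ y, 0 ≤ r y) (hrmax : ∀ y, r y ≤ rmax) (hcr : |c| * rmax + J < γ)
    (T : Finset m) (a b : T) :
    |(B.submatrix (fun j : T => (j : m)) (fun j : T => (j : m)))⁻¹ a b -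
        (B.submatrix (fun j : T => (j : m)) (fun j : T => (j : m)) +
          c • Matrix.diagonal (fun j : T => r j))⁻¹ a b| ≤
      (∑ y : T, |c| * r y * Real.exp (-(κ * dist (a : m) (y : m))) * Real.exp (-(κ * dist (y : m) (b : m)))) /
        ((γ - J) * (γ - |c| * rmax - J)) := by
  have hJ0 : 0 ≤ J := by
    refine le_trans (Finset.sum_nonneg fun e' _ => mul_nonneg (abs_nonneg _) ?_) (hJ (a : m))
    linarith [Real.one_le_cosh (κ * dist (a : m) e')]
  have hrmax0 : 0 ≤ rmax := le_trans (hr0 a) (hrmax a)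
  have hγ0 : 0 < γ := by nlinarith [abs_nonneg c]
  have hγ'0 : 0 < γ - |c| * rmax := by linarith
  have hMsymm : ∀ y y' : T, B.submatrix (fun j : T => (j : m)) (fun j : T => (j : m)) y y' =
      B.submatrix (fun j : T => (j : m)) (fun j : T => (j : m)) y' y := fun y y' => hB y y'
  have hMγ : ∀ x : T → ℝ, γ * ∑ y, x y ^ 2 ≤
      ∑ y, ∑ y', B.submatrix (fun j : T => (j : m)) (fun j : T => (j : m)) y y' * x y * x y' :=
    coercive_submatrix hγ T
  have hMJ : ∀ e : T, ∑ e' : T, |B.submatrix (fun j : T => (j : m)) (fun j : T => (j : m)) e e'| *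
      (Real.cosh (κ * dist (e : m) (e' : m)) - 1) ≤ J :=
    rowDefect_submatrix_le hJ T
  -- the shift `s = c·r|_T`
  have hsmul : c • Matrix.diagonal (fun j : T => r j) = Matrix.diagonal (fun j : T => c * r j) := by
    rw [← Matrix.diagonal_smul]
    rfl
  have hs : ∀ y : T, |(fun j : T => c * r j) y| ≤ |c| * rmax := fun y => by
    simp only [abs_mul, abs_of_nonneg (hr0 y)]
    exact mul_le_mul_of_nonneg_left (hrmax y) (abs_nonneg c)
  have hMγ' : ∀ x : T → ℝ, (γ - |c| * rmax) * ∑ y, x y ^ 2 ≤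
      ∑ y, ∑ y', (B.submatrix (fun j : T => (j : m)) (fun j : T => (j : m)) +
        Matrix.diagonal (fun j : T => c * r j)) y y' * x y * x y' :=
    coercive_add_diagonal_of_abs_le hMγ hs
  rw [hsmul]
  have h := abs_inv_sub_inv_add_diagonal_le (dist := fun y y' : T => dist (y : m) (y' : m)) hMsymm
    (fun e => hd0 e) (fun e e' => hdsymm e e') (fun e e' e'' => hdtri e e' e'') hγ0 hγ'0 hMγ
    (fun j : T => c * r j) hMγ' hMJ hκ hm (by linarith) a b
  refine h.trans (le_of_eq ?_)
  congr 1
  refine Finset.sum_congr rfl fun y _ => ?_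
  simp only [abs_mul, abs_of_nonneg (hr0 y)]

end ComparisonBoxes

/-! ## §5  What (5.31) reads at the class: one box `Λᶜ` («condition on everything outside»), Dirichlet-temperature covariance versus the
free covariance -/

section Dirichlet

variable {ι : Type*} [Fintype ι] [DecidableEq ι]
variable {A : Matrix ι ι ℝ} {dist : ι → ι → ℝ} {γ J κ : ℝ}

/-- **THE (5.31) INPUT FOR THE CLASS — comparison-box covariance versus free covariance.**  For `A` in the class (symmetric, `γ`-coercive,
Combes–Thomas rows `≤ J < γ` at rate `κ`, growth constants `Σ_{e′} e^{−(κ/2)dist e e′} ≤ V₂`, `Σ_{e′}|A e e′|e^{(κ/2)dist e e′} ≤ M₂`), a box written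
as `Λᶜ` and a diagonal temperature shift `s` on the box with `|s| ≤ s_max`, `s_max + J < γ`: for `y, y′` in the box at distances `≥ D_y`,
`≥ D_{y′}` from `Λ`,
`|((A|_{Λᶜ} + diag s)⁻¹)_{yy′} − G_{yy′}| ≤ (s_max V₂/((γ − J)(γ − s_max − J)))e^{−(κ/2)dist y y′} + (V₂M₂/(γ − J)²)e^{−(κ/2)(D_y + D_{y′})}`
— temperature shift (§2) + Dirichlet-versus-free ((C.7)-class, `B1Eq324BenfattoClassAppendixC.abs_cov_sub_schur_le_exp` with
`schur_eq_inv_submatrix_compl`).  With `…Sect5CondToFree.abs_ursellOf_dmoment_sub_le` this books the (5.31) «(error)» for a class edition.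
[cite: BenfattoEtAl1978, (5.31) p.158 with Appendix C (C.6)–(C.7) p.164 (class substitute; ours)] -/
theorem abs_inv_dirichletTemp_sub_cov_le (hA : ∀ e e', A e e' = A e' e)
    (hd0 : ∀ e, dist e e = 0) (hdsymm : ∀ e e', dist e e' = dist e' e)
    (hdtri : ∀ e e' e'', dist e e'' ≤ dist e e' + dist e' e'') (hγ0 : 0 < γ)
    (hγ : ∀ x : ι → ℝ, γ * ∑ e, x e ^ 2 ≤ ∑ e, ∑ e', A e e' * x e * x e')
    (hJ : ∀ e, ∑ e', |A e e'| * (Real.cosh (κ * dist e e') - 1) ≤ J) (hκ : 0 ≤ κ) (hm : J < γ)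
    {V₂ M₂ : ℝ} (hV : ∀ e, ∑ e', Real.exp (-(κ / 2 * dist e e')) ≤ V₂)
    (hM : ∀ e, ∑ e', |A e e'| * Real.exp (κ / 2 * dist e e') ≤ M₂)
    (Λ : Finset ι) (s : ↥Λᶜ → ℝ) {smax : ℝ} (hs : ∀ y, |s y| ≤ smax) (hsm : smax + J < γ)
    (y y' : ↥Λᶜ) {Dy Dy' : ℝ} (hDy : ∀ c ∈ Λ, Dy ≤ dist y c) (hDy' : ∀ c ∈ Λ, Dy' ≤ dist c y') :
    |(A.submatrix (fun j : ↥Λᶜ => (j : ι)) (fun j : ↥Λᶜ => (j : ι)) + Matrix.diagonal s)⁻¹ y y' - A⁻¹ y y'| ≤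
      smax * V₂ / ((γ - J) * (γ - smax - J)) * Real.exp (-(κ / 2 * dist y y')) +
        V₂ * M₂ / (γ - J) ^ 2 * Real.exp (-(κ / 2 * (Dy + Dy'))) := by
  set M : Matrix ↥Λᶜ ↥Λᶜ ℝ := A.submatrix (fun j : ↥Λᶜ => (j : ι)) (fun j : ↥Λᶜ => (j : ι)) with hMdef
  have hsmax0 : 0 ≤ smax := le_trans (abs_nonneg _) (hs y)
  have hγ'0 : 0 < γ - smax := by
    have hJ0 : 0 ≤ J := by
      refine le_trans (Finset.sum_nonneg fun e' _ => mul_nonneg (abs_nonneg _) ?_) (hJ (y : ι))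
      linarith [Real.one_le_cosh (κ * dist (y : ι) e')]
    linarith
  have hMsymm : ∀ a b : ↥Λᶜ, M a b = M b a := fun a b => hA a b
  have hMγ : ∀ x : ↥Λᶜ → ℝ, γ * ∑ a, x a ^ 2 ≤ ∑ a, ∑ b, M a b * x a * x b := coercive_submatrix hγ Λᶜ
  have hMJ : ∀ e : ↥Λᶜ, ∑ e' : ↥Λᶜ, |M e e'| * (Real.cosh (κ * dist (e : ι) (e' : ι)) - 1) ≤ J :=
    rowDefect_submatrix_le hJ Λᶜ
  have hMV : ∀ e : ↥Λᶜ, ∑ e' : ↥Λᶜ, Real.exp (-(κ / 2 * dist (e : ι) (e' : ι))) ≤ V₂ := growthSum_submatrix_le hV Λᶜ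
  have hMγ' : ∀ x : ↥Λᶜ → ℝ, (γ - smax) * ∑ a, x a ^ 2 ≤ ∑ a, ∑ b, (M + Matrix.diagonal s) a b * x a * x b :=
    coercive_add_diagonal_of_abs_le hMγ hs
  -- temperature part
  have hT := abs_inv_sub_inv_add_diagonal_le_exp (dist := fun a b : ↥Λᶜ => dist (a : ι) (b : ι)) hMsymm
    (fun e => hd0 e) (fun e e' => hdsymm e e') (fun e e' e'' => hdtri e e' e'') hγ0 hγ'0 hMγ s hMγ' hMJ hκ hm
    (by linarith) hs hMV y y'
  -- Dirichlet-versus-free part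
  have hPD : A.PosDef := posDef_of_coercive hA hγ0 hγ
  have hD := abs_cov_sub_schur_le_exp hA hd0 hdsymm hdtri hγ0 hγ hJ hκ hm hV hM Λ y y' hDy hDy'
  have hschur := schur_eq_inv_submatrix_compl hPD Λ y y'
  -- `G − C^Λ = G − M⁻¹`
  have hD' : |A⁻¹ y y' - M⁻¹ y y'| ≤ V₂ * M₂ / (γ - J) ^ 2 * Real.exp (-(κ / 2 * (Dy + Dy'))) := by
    have hcs := cov_sub_schur_eq hPD Λ y y'
    -- `A⁻¹ y y' − schur = Σ…` ; schur = M⁻¹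
    have : A⁻¹ y y' - M⁻¹ y y' =
        ∑ c : Λ, ∑ c' : Λ, A⁻¹ y c * (covGram (A⁻¹ : Matrix ι ι ℝ) Λ)⁻¹ c c' * A⁻¹ c' y' := by
      rw [← hschur]; ring
    rw [this]
    exact hD
  calc |(M + Matrix.diagonal s)⁻¹ y y' - A⁻¹ y y'|
      = |(M⁻¹ y y' - (M + Matrix.diagonal s)⁻¹ y y') + (A⁻¹ y y' - M⁻¹ y y')| := by
          rw [← abs_neg]; congr 1; ring
    _ ≤ |M⁻¹ y y' - (M + Matrix.diagonal s)⁻¹ y y'| + |A⁻¹ y y' - M⁻¹ y y'| := abs_add_le _ _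
    _ ≤ _ := add_le_add hT hD'

/-- **The (5.31) input, PROFILE edition**: if the temperature shift decays into the box, `|s_y| ≤ s₀e^{−κ′ρ(y)}` along a 1-Lipschitz profile
`ρ` that minorises the distance to `Λ` (`ρ(y) ≤ dist y c` for `c ∈ Λ`), `0 ≤ κ′ ≤ κ/2`, then
`|((A|_{Λᶜ} + diag s)⁻¹)_{yy′} − G_{yy′}| ≤ (s₀V₂/((γ − J)(γ′ − J)))e^{−κ′ρ(y)}e^{−(κ/2)dist y y′} + (V₂M₂/(γ − J)²)e^{−(κ/2)(ρ(y) + ρ(y′))}`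
(`γ′` = the coercivity constant of the shifted box precision) — both terms are small DEEP INSIDE the box, the printed shape of (5.31).
[cite: BenfattoEtAl1978, (5.31) p.158 with Appendix C (C.6)–(C.7) p.164 (class substitute; ours)] -/
theorem abs_inv_dirichletTemp_sub_cov_le_profile (hA : ∀ e e', A e e' = A e' e)
    (hd0 : ∀ e, dist e e = 0) (hdsymm : ∀ e e', dist e e' = dist e' e)
    (hdtri : ∀ e e' e'', dist e e'' ≤ dist e e' + dist e' e'') (hγ0 : 0 < γ)
    (hγ : ∀ x : ι → ℝ, γ * ∑ e, x e ^ 2 ≤ ∑ e, ∑ e', A e e' * x e * x e')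
    (hJ : ∀ e, ∑ e', |A e e'| * (Real.cosh (κ * dist e e') - 1) ≤ J) (hκ : 0 ≤ κ) (hm : J < γ)
    {V₂ M₂ : ℝ} (hV : ∀ e, ∑ e', Real.exp (-(κ / 2 * dist e e')) ≤ V₂)
    (hM : ∀ e, ∑ e', |A e e'| * Real.exp (κ / 2 * dist e e') ≤ M₂)
    (Λ : Finset ι) (s : ↥Λᶜ → ℝ) {γ' : ℝ} (hγ'0 : 0 < γ') (hm' : J < γ')
    (hγ' : ∀ x : ↥Λᶜ → ℝ, γ' * ∑ a, x a ^ 2 ≤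
      ∑ a, ∑ b, (A.submatrix (fun j : ↥Λᶜ => (j : ι)) (fun j : ↥Λᶜ => (j : ι)) + Matrix.diagonal s) a b * x a * x b)
    {s₀ κ' : ℝ} (ρ : ι → ℝ) (hρ : ∀ a b, ρ a ≤ ρ b + dist a b) (hρΛ : ∀ a, ∀ c ∈ Λ, ρ a ≤ dist a c)
    (hκ' : 0 ≤ κ') (hκ'2 : κ' ≤ κ / 2) (hs0 : 0 ≤ s₀) (hs : ∀ y : ↥Λᶜ, |s y| ≤ s₀ * Real.exp (-(κ' * ρ y)))
    (y y' : ↥Λᶜ) :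
    |(A.submatrix (fun j : ↥Λᶜ => (j : ι)) (fun j : ↥Λᶜ => (j : ι)) + Matrix.diagonal s)⁻¹ y y' - A⁻¹ y y'| ≤
      s₀ * V₂ / ((γ - J) * (γ' - J)) * Real.exp (-(κ' * ρ y)) * Real.exp (-(κ / 2 * dist y y')) +
        V₂ * M₂ / (γ - J) ^ 2 * Real.exp (-(κ / 2 * (ρ y + ρ y'))) := by
  set M : Matrix ↥Λᶜ ↥Λᶜ ℝ := A.submatrix (fun j : ↥Λᶜ => (j : ι)) (fun j : ↥Λᶜ => (j : ι)) with hMdef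
  have hMsymm : ∀ a b : ↥Λᶜ, M a b = M b a := fun a b => hA a b
  have hMγ : ∀ x : ↥Λᶜ → ℝ, γ * ∑ a, x a ^ 2 ≤ ∑ a, ∑ b, M a b * x a * x b := coercive_submatrix hγ Λᶜ
  have hMJ : ∀ e : ↥Λᶜ, ∑ e' : ↥Λᶜ, |M e e'| * (Real.cosh (κ * dist (e : ι) (e' : ι)) - 1) ≤ J :=
    rowDefect_submatrix_le hJ Λᶜ
  have hMV : ∀ e : ↥Λᶜ, ∑ e' : ↥Λᶜ, Real.exp (-(κ / 2 * dist (e : ι) (e' : ι))) ≤ V₂ := growthSum_submatrix_le hV Λᶜ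
  -- temperature part, profile edition
  have hT := abs_inv_sub_inv_add_diagonal_le_profile (dist := fun a b : ↥Λᶜ => dist (a : ι) (b : ι)) hMsymm
    (fun e => hd0 e) (fun e e' => hdsymm e e') (fun e e' e'' => hdtri e e' e'') hγ0 hγ'0 hMγ s hγ' hMJ hκ hm hm'
    (fun a : ↥Λᶜ => ρ a) (fun a b => hρ a b) hκ' hκ'2 hs0 hs hMV y y'
  -- Dirichlet-versus-free part at `D_y = ρ y`, `D_{y′} = ρ y′`
  have hPD : A.PosDef := posDef_of_coercive hA hγ0 hγ
  have hDy : ∀ c ∈ Λ, ρ y ≤ dist y c := fun c hc => hρΛ y c hc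
  have hDy' : ∀ c ∈ Λ, ρ y' ≤ dist c y' := fun c hc => by rw [hdsymm]; exact hρΛ y' c hc
  have hD := abs_cov_sub_schur_le_exp hA hd0 hdsymm hdtri hγ0 hγ hJ hκ hm hV hM Λ y y' hDy hDy'
  have hschur := schur_eq_inv_submatrix_compl hPD Λ y y'
  have hD' : |A⁻¹ y y' - M⁻¹ y y'| ≤ V₂ * M₂ / (γ - J) ^ 2 * Real.exp (-(κ / 2 * (ρ y + ρ y'))) := by
    have : A⁻¹ y y' - M⁻¹ y y' =
        ∑ c : Λ, ∑ c' : Λ, A⁻¹ y c * (covGram (A⁻¹ : Matrix ι ι ℝ) Λ)⁻¹ c c' * A⁻¹ c' y' := by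
      rw [← hschur]; ring
    rw [this]
    exact hD
  calc |(M + Matrix.diagonal s)⁻¹ y y' - A⁻¹ y y'|
      = |(M⁻¹ y y' - (M + Matrix.diagonal s)⁻¹ y y') + (A⁻¹ y y' - M⁻¹ y y')| := by
          rw [← abs_neg]; congr 1; ring
    _ ≤ |M⁻¹ y y' - (M + Matrix.diagonal s)⁻¹ y y'| + |A⁻¹ y y' - M⁻¹ y y'| := abs_add_le _ _
    _ ≤ _ := add_le_add hT hD'

end Dirichlet

end Literature.MathematicalPhysics.QuantumFieldTheory.Balaban1983to89.B1Eq324BenfattoClassComparisonBoxes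

end
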